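import Summits.QuantumFields.YangMills.Theorems.BalabanUVNodesN11NoExpansionClauseGaussCertWitness
import Literature.MathematicalPhysics.QuantumFieldTheory.Balaban1983to89.Node00.Record13SepCoPHChi
import Literature.MathematicalPhysics.QuantumFieldTheory.Balaban1983to89.Node00.Record13ResidualsRChi
import Summits.QuantumFields.YangMills.Theorems.BalabanUVNodesN11HistoryPinnedResidualDefsChi
import Summits.QuantumFields.YangMills.Theorems.BalabanUVNodesN11RePinnedParamDefsChi
import Summits.QuantumFields.YangMills.Theorems.BalabanUVNodesN11NoExpansionAtRecord13CoPChi
import Summits.QuantumFields.YangMills.Theorems.BalabanUVNodesN11NoExpansionDiagonalCoPHChi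
import Summits.QuantumFields.YangMills.Theorems.BalabanUVNodesN11BackgroundScaleLocalChi
import Summits.QuantumFields.YangMills.Theorems.BalabanUVNodesN11NoExpansionOldFactorsChi
import Summits.QuantumFields.YangMills.Theorems.BalabanUVNodesN11NoExpansionGeneralStepCoPHOldBranchChi
import Summits.QuantumFields.YangMills.Theorems.BalabanUVNodesN11NoExpansionGeneralStepGraphChi
import Summits.QuantumFields.YangMills.Theorems.BalabanUVNodesN11DiagonalOldBranchMeasurableChi
import Summits.QuantumFields.YangMills.Theorems.BalabanUVNodesN11OldBranchPairChi
import Summits.QuantumFields.YangMills.Theorems.BalabanUVNodesN11TruncationDominationChi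
import Summits.QuantumFields.YangMills.Theorems.BalabanUVNodesN11GaussianCertificateRowsChi
import Summits.QuantumFields.YangMills.Theorems.BalabanUVNodesN11Sect3SupplyChainObligationsDefs
import Summits.QuantumFields.YangMills.Theorems.BalabanUVNodesN11Sect3SupplyPresentParentsChi
import Summits.QuantumFields.YangMills.Theorems.BalabanUVNodesN11NoExpansionGeneralStepLawsCoPHChi
import Summits.QuantumFields.YangMills.Theorems.BalabanUVNodesN11Sect3SupplySplicePairChi
import Summits.QuantumFields.YangMills.Theorems.BalabanUVNodesN11Sect3SupplyChainDefsChi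
import Summits.QuantumFields.YangMills.Theorems.BalabanUVNodesN11Sect3SupplyChainChi

/-!
# χ-GENERIC RE-ISSUE (WORK ORDER RC-1) — MERGED MODULE `BalabanUVNodesN11Sect3SupplyChainObligationsPairChi` holding the sibling twins of `BalabanUVNodesN11NoExpansionClauseGaussCertWitness`, `BalabanUVNodesN11Sect3SupplyChainObligationsDefs`

(dag-n11-d g44, N11-σ chain; one file = fewer gate∕farm round-trips; each member keeps its own sibling namespace `…<Member>Chi` and its own header below.)
-/

/-!
# χ-GENERIC RE-ISSUE (WORK ORDER RC-1 «RE-CENTRE THE RECORD», director-ym №462 (B) ∕ №467 (D)) of `BalabanUVNodesN11NoExpansionClauseGaussCertWitness`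

Cell `pub-ymgap` (HUMAN RULING D-0062, Track A), seat `pub-ymgap-dag-n11-d` (N11 [B14] s2; N11-σ campaign, `N11-G44-RC1-REACH-CENSUS.md`).  The CENTRE-TYPED
declarations of `BalabanUVNodesN11NoExpansionClauseGaussCertWitness` (those whose statement reads the (2.9) cut-off centre through `gOfRecord₁₃ ∕ EOfRecord₁₃ ∕ Provisos₁₃… ∕ T∕SLaw₁₃… ∕
UbgOfRecord₁₃… ∕ WtOfRecord₁₃… ∕ datum∕tower∕coreOfRecord₁₃…`) RE-ISSUED VERBATIM in the β-slot `χ : ChiSlot F N` over [Ax-3b]∕[Ax-3c]∕[Ax-3d]'s χ-generic carriers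
(`Node00/Record13Chi` ∕ `Record13CoPHChi` ∕ `Record13SepCoPHChi`): σ = (binder `(χ : ChiSlot F N)` after `θ`; Node00 defs `X ↦ XChi … χ`; Node00 rows `Y ↦ Y_chi`;
this lane's sibling modules `…Chi` for Summits-side dependencies); SAME short names in the sibling namespace `…BalabanUVNodesN11NoExpansionClauseGaussCertWitnessChi` (consumers switch by namespace);
the 1 centre-FREE declarations of the original are NOT copied — they are reused BY NAME (`open … (…)` below).  At `χ := chiβOfRecord₁₃ θ` every statement here is
DEFINITIONALLY the landed one ([Ax-3b]'s `rfl` receipts); at `χ := chiβOfRecord₁₃Ax θ` it is what the Ax-record's N11 machine reads.  Nothing of record edited (body-freeze №460 (2)).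

HONEST FRAMING.  Count-neutral kernel re-elaboration of landed N11 bookkeeping∕estimates in a parameter; every HYPOTHESIS of the original stays a hypothesis; nothing of
Bałaban asserted beyond what the original file proves; N11 NOT discharged; K-items untouched; counts unmoved.  One finite `𝕋⁴_{L^K}` programme at fixed `ε = L^{−K}` —
NOT ℝ⁴, NOT OS, NOT a mass gap, NOT Clay.  No `sorry`∕`instance`∕`notation`.  Sources: as the original module, plus [I] = [Balaban1987RG1] (2.9) p.266 (the cut-off's centre).
-/

noncomputable section

open MeasureTheory
open scoped BigOperators ENNReal NNReal Matrix.Norms.L2Operator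

namespace Summit.QuantumFields.YangMills.Theorems.BalabanUVNodesN11NoExpansionClauseGaussCertWitnessChi

open Summit.QuantumFields.YangMills.Theorems.BalabanUVNodesN11NoExpansionClauseGaussCertWitness (noExpansionClause_of_gaussCert_of_witnessFamily)
open Literature.MathematicalPhysics.QuantumFieldTheory.Balaban1983to89 T4Continuum Node00 Node00.Tk
open B10Eq42TorusConstraint (bondsIn)
open BalabanUVNodesN11HistoryPinnedResidualDefsChi (ZhPinOfRecord₁₃)
open BalabanUVNodesN11FluctTruncationDefs (IsFluctLocal action23_sect2ActionDataOfRecord_congr_fluct_of_isFluctLocal)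
open BalabanUVNodesN11NoExpansionOldBranchGraphChi (clause_succ_CoPH_of_Omega_empty_of_pinChi_of_oldBranch_of_clause_of_graph)
open BalabanUVNodesN11AFibreDominationOfCoerciveChi (integrable_oldBranch_of_coercive)
open BalabanUVNodesN11GaussianCertificateRows hiding coercive_of_gaussCert measurable_quad_of_gaussCert measurable_ζ0_of_gaussCert prefix_agree_of_gaussCert quad_empty_pairCfgAt_of_gaussCert quad_local_of_gaussCert zhAt_quad_apply zhAt_ζ0_eq_rePinH zhUnity_of_gaussCert ζ0_pin_of_gaussCert
open BalabanUVNodesN11GaussianCertificateRowsChi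

variable {F : T4Family} {N : ℕ} [NeZero N]
variable (θ : Stage13HParams F N) (χ : ChiSlot F N) (p : B12.RunParams)

/-! ## §1  ★★★ One no-expansion history, one witness value -/

/-- **★★★ THE NO-EXPANSION 𝐓-IMAGE CLAUSE AT A GAUSSIAN CERTIFICATE FOR A GIVEN WITNESS VALUE**: for `θ` of the Gaussian class (certificate `ζ0`, A-fibre Gaussian `quad`) with
core provisos, `k < K`, `1 ≤ M`, a no-expansion history `s′` of length `k+1`, and ANY `k`-local term value `t` with constant `E₀` carrying the level-`k` dichotomy of `ρ_k` at
`init s′` (zero, or the §2 form `sect2Slot … t E₀` a.e. on `supp χ_k`): the 𝐓-image clause at `s′` for `(t, E₀)` holds as soon as, for every old branch, the operand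
`exp A_k(init s′)[t, E₀]` is measurable and bounded on the multiscale configuration space (def-T's rows).  dag-n11-d's per-witness door (d1)+(d2) face, door (d3) by
dag-n11-w4's coercive integrability, every residual row by `…N11GaussianCertificateRows`.
[cite: Balaban1988Convergent, Theorem p.245, Thm 1 p.262, (3.24)–(3.25) p.270, (2.18) p.257, (2.21)–(2.23) p.258, (3.16)–(3.21) pp.268–269] -/
theorem clause_succ_of_gaussCert_of_witness
    (hζ : ∀ (p : B12.RunParams) (n : ℕ) (Ω Λ : ℕ → Set (Site (F.P p.K) 0)), (θ.Zh p n Ω Λ).ζ0 = (ZhPinOfRecord₁₃ θ.toStage13Params χ p Ω Λ).ζ0)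
    (hq : ∀ (p : B12.RunParams) (n : ℕ) (Ω Λ : ℕ → Set (Site (F.P p.K) 0)) (j : ℕ) (Λ' : Set (Site (F.P p.K) 0)) (ω : MultiCfg (F.P p.K) (SU N) (FluctV N)),
      (θ.Zh p n Ω Λ).quad j Λ' ω = ∑ b ∈ (Set.toFinite (bondsIn j (Λ'ᶜ ∩ Ω (j + 1)))).toFinset, ‖(ω j).2 b‖ ^ 2)
    (h : θ.Provisos₁₃CoPHChi F N χ) {k : ℕ} (hk : k < p.K) (hM : 1 ≤ θ.τ9.M)
    (s : SeqOfRecord F θ.ν θ.τ9.M (gOfRecord₁₃Chi F N θ.toStage13Params χ p) p.K (k + 1)) (hΩ : s.Ω (k + 1) = ∅)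
    (t : Sect2.TermValues (F.P p.K) (MatA N) (FluctV N) θ.τ9.M) (E₀ : ℝ) (hloc : IsFluctLocal k t)
    (hid : slotsOfRecord F N θ.ν θ.τ9 (EOfRecord₁₃Chi F N θ.toStage13Params χ) (wOfRecord₉ F N θ.toStage9Params) θ.ppSel p
        (gOfRecord₁₃Chi F N θ.toStage13Params χ p) k s.init = 0 ∨
      ∀ᵐ U₀ ∂fieldMeasure (F.P p.K) k (SU N),
        chiSeqOfRecord F N θ.ν θ.τ9.M (gOfRecord₁₃Chi F N θ.toStage13Params χ p) p.K k s.init U₀ ≠ 0 →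
          slotsOfRecord F N θ.ν θ.τ9 (EOfRecord₁₃Chi F N θ.toStage13Params χ) (wOfRecord₉ F N θ.toStage9Params) θ.ppSel p
              (gOfRecord₁₃Chi F N θ.toStage13Params χ p) k s.init U₀ =
            sect2Slot F N (FluctV N) p.K (settingOfRecord₁₃Chi F N θ.toStage13Params χ p) (θ.rzAtChi χ p s.init) (WtOfRecord₁₃HChi F N θ χ p s.init) s.init t E₀
              (UbgOfRecord₁₃CoPChi F N θ.toStage13Params χ p k s.init) U₀)
    (hΦ : ∀ S ∈ admSOfRecord F θ.ν θ.τ9.M (gOfRecord₁₃Chi F N θ.toStage13Params χ p) p.K k s.init,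
      Measurable (fun ω : MultiCfg (F.P p.K) (SU N) (FluctV N) =>
        sect2Operand F N (FluctV N) p.K (settingOfRecord₁₃Chi F N θ.toStage13Params χ p) (θ.rzAtChi χ p s.init) s.init t E₀
            (UbgOfRecord₁₃CoPChi F N θ.toStage13Params χ p k s.init) (S, fun j => (ω j).2) (fun j => (ω j).1)) ∧
      ∃ CΦ : ℝ, ∀ a U, sect2Operand F N (FluctV N) p.K (settingOfRecord₁₃Chi F N θ.toStage13Params χ p) (θ.rzAtChi χ p s.init) s.init t E₀
            (UbgOfRecord₁₃CoPChi F N θ.toStage13Params χ p k s.init) a U ≤ CΦ) :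
    slotsTOfRecord F N θ.ν θ.τ9 (EOfRecord₁₃Chi F N θ.toStage13Params χ) (wOfRecord₉ F N θ.toStage9Params) θ.ppSel p
        (gOfRecord₁₃Chi F N θ.toStage13Params χ p) (k + 1) s = 0 ∨
      ∀ᵐ V' ∂fieldMeasure (F.P p.K) (k + 1) (SU N),
        chiSeqOfRecord F N θ.ν θ.τ9.M (gOfRecord₁₃Chi F N θ.toStage13Params χ p) p.K (k + 1) s V' ≠ 0 →
          slotsTOfRecord F N θ.ν θ.τ9 (EOfRecord₁₃Chi F N θ.toStage13Params χ) (wOfRecord₉ F N θ.toStage9Params) θ.ppSel p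
              (gOfRecord₁₃Chi F N θ.toStage13Params χ p) (k + 1) s V' =
            sect2Slot F N (FluctV N) p.K (settingOfRecord₁₃Chi F N θ.toStage13Params χ p) (θ.rzAtChi χ p s) (WtOfRecord₁₃HChi F N θ χ p s) s t E₀
              (UbgOfRecord₁₃CoPChi F N θ.toStage13Params χ p (k + 1) s) V' := by
  refine clause_succ_CoPH_of_Omega_empty_of_pinChi_of_oldBranch_of_clause_of_graph θ χ p h hk hM s hΩ (quad_local_of_gaussCert θ χ p hq s)
    (prefix_agree_of_gaussCert θ χ p hζ hq s hΩ) t E₀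
    (fun S a a' Uf ha => action23_sect2ActionDataOfRecord_congr_fluct_of_isFluctLocal p.K _ _ s.init hloc E₀ S a a' ha Uf)
    hid (ζ0_pin_of_gaussCert θ χ p hζ hk s hΩ) (quad_empty_pairCfgAt_of_gaussCert θ χ p hq s) fun S hSm => ?_
  obtain ⟨hΦm, CΦ, hΦle⟩ := hΦ S hSm
  exact integrable_oldBranch_of_coercive θ χ p h.zhLaws (zhUnity_of_gaussCert θ χ hζ) s S (fun j Y => measurable_ζ0_of_gaussCert θ χ p hζ h s j Y)
    (fun j Λ' => measurable_quad_of_gaussCert θ χ p hq s j Λ') (coercive_of_gaussCert θ χ p hq s)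
    (Φ := sect2Operand F N (FluctV N) p.K (settingOfRecord₁₃Chi F N θ.toStage13Params χ p) (θ.rzAtChi χ p s.init) s.init t E₀
      (UbgOfRecord₁₃CoPChi F N θ.toStage13Params χ p k s.init))
    hΦm (fun a U => (sect2Operand_pos p.K _ _ s.init t E₀ _ a U).le) CΦ hΦle

/-! ## §2  ★★ Every no-expansion history, for an exposed k-local witness family -/

end Summit.QuantumFields.YangMills.Theorems.BalabanUVNodesN11NoExpansionClauseGaussCertWitnessChi

end



/-!
# χ-GENERIC RE-ISSUE (WORK ORDER RC-1 «RE-CENTRE THE RECORD», director-ym №462 (B) ∕ №467 (D)) of `BalabanUVNodesN11Sect3SupplyChainObligationsDefs`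

Cell `pub-ymgap` (HUMAN RULING D-0062, Track A), seat `pub-ymgap-dag-n11-d` (N11 [B14] s2; N11-σ campaign, `N11-G44-RC1-REACH-CENSUS.md`).  The CENTRE-TYPED
declarations of `BalabanUVNodesN11Sect3SupplyChainObligationsDefs` (those whose statement reads the (2.9) cut-off centre through `gOfRecord₁₃ ∕ EOfRecord₁₃ ∕ Provisos₁₃… ∕ T∕SLaw₁₃… ∕
UbgOfRecord₁₃… ∕ WtOfRecord₁₃… ∕ datum∕tower∕coreOfRecord₁₃…`) RE-ISSUED VERBATIM in the β-slot `χ : ChiSlot F N` over [Ax-3b]∕[Ax-3c]∕[Ax-3d]'s χ-generic carriers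
(`Node00/Record13Chi` ∕ `Record13CoPHChi` ∕ `Record13SepCoPHChi`): σ = (binder `(χ : ChiSlot F N)` after `θ`; Node00 defs `X ↦ XChi … χ`; Node00 rows `Y ↦ Y_chi`;
this lane's sibling modules `…Chi` for Summits-side dependencies); SAME short names in the sibling namespace `…BalabanUVNodesN11Sect3SupplyChainObligationsDefsChi` (consumers switch by namespace);
the 9 centre-FREE declarations of the original are NOT copied — they are reused BY NAME (`open … (…)` below).  At `χ := chiβOfRecord₁₃ θ` every statement here is
DEFINITIONALLY the landed one ([Ax-3b]'s `rfl` receipts); at `χ := chiβOfRecord₁₃Ax θ` it is what the Ax-record's N11 machine reads.  Nothing of record edited (body-freeze №460 (2)).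

HONEST FRAMING.  Count-neutral kernel re-elaboration of landed N11 bookkeeping∕estimates in a parameter; every HYPOTHESIS of the original stays a hypothesis; nothing of
Bałaban asserted beyond what the original file proves; N11 NOT discharged; K-items untouched; counts unmoved.  One finite `𝕋⁴_{L^K}` programme at fixed `ε = L^{−K}` —
NOT ℝ⁴, NOT OS, NOT a mass gap, NOT Clay.  No `sorry`∕`instance`∕`notation`.  Sources: as the original module, plus [I] = [Balaban1987RG1] (2.9) p.266 (the cut-off's centre).
-/

noncomputable section

open MeasureTheory
open scoped BigOperators ENNReal NNReal Matrix.Norms.L2Operator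

namespace Summit.QuantumFields.YangMills.Theorems.BalabanUVNodesN11Sect3SupplyChainObligationsDefsChi

open Summit.QuantumFields.YangMills.Theorems.BalabanUVNodesN11Sect3SupplyChainObligationsDefs (chainFormAt_iff chainFormTAt_iff chainFormAt_zero sLaw₁₃CoPH_of_chainFormAt ResidualRowsAt ResidualRows sLaw₁₃CoPH_all_of_obligations sLaw₁₃CoPH_all_of_supplyChainAt noExpansionObligation_of_residualRows_of_operandRows)
open Literature.MathematicalPhysics.QuantumFieldTheory.Balaban1983to89 T4Continuum Node00 Node00.Tk
open B10Eq42TorusConstraint (bondsIn)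
open BalabanUVNodesN11HistoryPinnedResidualDefsChi (ZhPinOfRecord₁₃)
open BalabanUVNodesN11FluctTruncationDefs (IsFluctLocal)
open BalabanUVNodesN11Sect3SupplyPresentParentsChi (slotsTOfRecord₁₃H_succ_eq_zero_of_init_eq_zero)
open BalabanUVNodesN11Sect3SupplyChainDefs hiding NewEClausesAt NoExpansionClauseFor PresentChildObligations Sect3Supplier baseWitness baseWitness_form chainWitness isFluctLocal_baseWitness isFluctLocal_chainWitness isFluctLocal_spliceTermsB spliceConst spliceConst_of_Omega_empty spliceConst_of_Omega_ne spliceTermsB spliceTermsB_E spliceTermsB_of_Omega_empty spliceTermsB_of_absent spliceTermsB_of_present universalE_spliceTermsB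
open BalabanUVNodesN11Sect3SupplyChainDefsChi
open BalabanUVNodesN11Sect3SupplyChainChi (formAtZS_chainWitness formT_spliceTermsB_of_rows)
open BalabanUVNodesN11Sect3SupplyChainRows (noExpansionClauseFor_of_form_of_local_of_rows)
open BalabanUVNodesN11NoExpansionClauseGaussCertWitnessChi (clause_succ_of_gaussCert_of_witness)

variable {F : T4Family} {N : ℕ} [NeZero N]
variable (θ : Stage13HParams F N) (χ : ChiSlot F N) (p : B12.RunParams)

/-! ## §1  The chain's inductive hypothesis and its 𝐓-image, named -/

section Form

/-- **THE CHAIN's LEVEL-`k` WITNESS HAS THE §2 FORM OF `ρ_k`** (def-T's `HasSect2FormAtZS` at index `k`, laws `Sect2.LawsRT … k`, post-𝐑 slots of record, AT the named witness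
`chainWitness θ χ p σ k`) — print's inductive hypothesis of §3 on «the terms constructed so far».  The displayed antecedent of every per-level hand-over, VERBATIM.
[cite: Balaban1988Convergent, Thm 1 p.262, (2.18) p.257, (2.23) p.258, §3 p.279] -/
def ChainFormAt (σ : Sect3Supplier θ χ p) (k : ℕ) : Prop :=
  HasSect2FormAtZS F N (FluctV N) p.K (settingOfRecord₁₃Chi F N θ.toStage13Params χ p) k (θ.rzAtChi χ p) (WtOfRecord₁₃HChi F N θ χ p) (UbgOfRecord₁₃CoPChi F N θ.toStage13Params χ p k)
    (fun s u => Sect2.LawsRT (sect2TowerOfRecord F N (FluctV N) p.K (settingOfRecord₁₃Chi F N θ.toStage13Params χ p) (θ.rzAtChi χ p s) s u) (settingOfRecord₁₃Chi F N θ.toStage13Params χ p).lf k)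
    (slotsOfRecord F N θ.ν θ.τ9 (EOfRecord₁₃Chi F N θ.toStage13Params χ) (wOfRecord₉ F N θ.toStage9Params) θ.ppSel p (gOfRecord₁₃Chi F N θ.toStage13Params χ p) k)
    (chainWitness θ χ p σ k).1 (chainWitness θ χ p σ k).2

/-- **THE CHAIN's LEVEL-`(k+1)` WITNESS IS A 𝐓-IMAGE WITNESS AT LEVEL `k`** (def-T's `HasSect2FormAtZS` at length `k+1` with the laws `Sect2.LawsT … k` and the PRE-𝐑 slots
`𝐓ρ_k` of record) — the body of `TLaw₁₃CoPH θ p k` at the named witness (the splice of the level-`k` chain witness with the supplier's response).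
[cite: Balaban1988Convergent, remark p.262, §3 p.279, (3.24)–(3.25) p.270] -/
def ChainFormTAt (σ : Sect3Supplier θ χ p) (k : ℕ) : Prop :=
  HasSect2FormAtZS F N (FluctV N) p.K (settingOfRecord₁₃Chi F N θ.toStage13Params χ p) (k + 1) (θ.rzAtChi χ p) (WtOfRecord₁₃HChi F N θ χ p) (UbgOfRecord₁₃CoPChi F N θ.toStage13Params χ p (k + 1))
    (fun s u => Sect2.LawsT (sect2TowerOfRecord F N (FluctV N) p.K (settingOfRecord₁₃Chi F N θ.toStage13Params χ p) (θ.rzAtChi χ p s) s u) (settingOfRecord₁₃Chi F N θ.toStage13Params χ p).lf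
      (settingOfRecord₁₃Chi F N θ.toStage13Params χ p).βc k)
    (slotsTOfRecord F N θ.ν θ.τ9 (EOfRecord₁₃Chi F N θ.toStage13Params χ) (wOfRecord₉ F N θ.toStage9Params) θ.ppSel p (gOfRecord₁₃Chi F N θ.toStage13Params χ p) (k + 1))
    (chainWitness θ χ p σ (k + 1)).1 (chainWitness θ χ p σ (k + 1)).2

variable {θ χ p}

/-- `ChainFormTAt θ χ p σ k` gives `TLaw₁₃CoPH θ p k` (def-T's `tLaw₁₃CoPH_iff_chi`). [cite: Balaban1988Convergent, remark p.262, (3.25) p.270] -/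
theorem tLaw₁₃CoPH_of_chainFormTAt {σ : Sect3Supplier θ χ p} {k : ℕ} (h : ChainFormTAt θ χ p σ k) : TLaw₁₃CoPHChi F N θ χ p k :=
  (tLaw₁₃CoPH_iff_chi F N θ χ p k).mpr ⟨_, _, h⟩

end Form

/-! ## §2  The supplier's obligations along its own chain ([III] §3's content, named) and the no-expansion obligation (dag-n11-d's lane, named) -/

section Obligations

/-- **THE SUPPLIER's OBLIGATIONS ALONG ITS OWN CHAIN — WHAT [III] §3 MUST DELIVER**, keyed to the supplier's own constructed terms: (loc) every response is `(k+1)`-local in the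
fluctuation variables ((2.40)–(2.41): `𝐁^{(k+1)}` reads fluctuation fields of generations `≤ k+1`); and, per level `k < K`, GIVEN the inductive hypothesis `ChainFormAt θ χ p σ k`:
(univE) the response is universal in 𝐄; (newE) the four level-`(k+1)` 𝐄-clauses at every history; (present) `PresentChildObligations` at every 𝐓-present expansion child ((O1′)
its own `𝐁^{(k)}` on the child's space, (O2) r11's new-term obligations `Step.LFNewTerms` + analyticity at `k+1` — the inductive bounds (2.28) ∕ (2.31) ∕ (2.42) for the NEW terms,
«the corresponding space» of Def. p.279 —, (O3′) the 𝐓-image identity for the splice).  The four displayed hypothesis families of `…Sect3SupplyChain.formAtZS_chainWitness` ∕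
`…ChainRows`, VERBATIM.  Nothing claimed: a structure of hypotheses.
[cite: Balaban1988Convergent, Thm 1 p.262, §3 p.279, (3.24)–(3.25) p.270, (2.27)–(2.31) pp.259–260, (2.38)–(2.42) p.261] -/
structure SupplierObligations (σ : Sect3Supplier θ χ p) : Prop where
  /-- (loc) every response is `(k+1)`-local in the fluctuation variables. -/
  loc : ∀ k (s : SeqOfRecord F θ.ν θ.τ9.M (gOfRecord₁₃Chi F N θ.toStage13Params χ p) p.K (k + 1)), IsFluctLocal (k + 1) ((σ k (chainWitness θ χ p σ k).1 (chainWitness θ χ p σ k).2).1 s)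
  /-- (univE) the response is universal in 𝐄. -/
  univE : ∀ k, k < p.K → ChainFormAt θ χ p σ k → Sect2.UniversalE (σ k (chainWitness θ χ p σ k).1 (chainWitness θ χ p σ k).2).1
  /-- (newE) the four level-`(k+1)` 𝐄-clauses at every history of length `k+1`. -/
  newE : ∀ k, k < p.K → ChainFormAt θ χ p σ k →
    ∀ s : SeqOfRecord F θ.ν θ.τ9.M (gOfRecord₁₃Chi F N θ.toStage13Params χ p) p.K (k + 1), NewEClausesAt θ χ p k ((σ k (chainWitness θ χ p σ k).1 (chainWitness θ χ p σ k).2).1 s) s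
  /-- (present) the obligations at every 𝐓-present expansion child. -/
  present : ∀ k, k < p.K → ChainFormAt θ χ p σ k →
    ∀ s : SeqOfRecord F θ.ν θ.τ9.M (gOfRecord₁₃Chi F N θ.toStage13Params χ p) p.K (k + 1), s.Ω (k + 1) ≠ ∅ →
      slotsTOfRecord F N θ.ν θ.τ9 (EOfRecord₁₃Chi F N θ.toStage13Params χ) (wOfRecord₉ F N θ.toStage9Params) θ.ppSel p (gOfRecord₁₃Chi F N θ.toStage13Params χ p) (k + 1) s ≠ 0 →
      PresentChildObligations θ χ p k (chainWitness θ χ p σ k).1 (σ k (chainWitness θ χ p σ k).1 (chainWitness θ χ p σ k).2).1 (σ k (chainWitness θ χ p σ k).1 (chainWitness θ χ p σ k).2).2 s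

/-- **THE NO-EXPANSION OBLIGATION ALONG THE CHAIN** (dag-n11-d's lane): per level `k < K`, given `ChainFormAt θ χ p σ k`, their `NoExpansionClauseFor` for the chain's level-`k`
witness.  The fifth displayed hypothesis family of `…Sect3SupplyChain.formAtZS_chainWitness`, VERBATIM; DISCHARGED in §5 from the rows. [cite: Balaban1988Convergent, Theorem p.245, (3.24)–(3.25) p.270, (2.17)–(2.18) p.257] -/
def NoExpansionObligation (σ : Sect3Supplier θ χ p) : Prop :=
  ∀ k, k < p.K → ChainFormAt θ χ p σ k → NoExpansionClauseFor θ χ p k (chainWitness θ χ p σ k).1 (chainWitness θ χ p σ k).2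

/-- **N11's RESIDUAL AT `(θ, p)` ON THE CHAIN ROAD, ONE TOKEN**: SOME supplier carries its obligations along its own chain ([III] §3) and the no-expansion obligation for that chain
(dag-n11-d's lane).  This — and nothing weaker that the tree knows — gives Theorem 1 ∕ the Theorem of p. 245 at `(θ, p)` on the live-selector line (§4); the older ∀-exposed-witness
pair `NoExpansionTStepAt ∧ Sect3SpliceSupplyAt` (`…Sect3SupplyDefs ∕ …SpliceDefs`) is stronger.  Nothing claimed. [cite: Balaban1988Convergent, Thm 1 p.262, Theorem p.245, §3 p.279 (bookkeeping)] -/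
def SupplyChainAt (θ : Stage13HParams F N) (χ : ChiSlot F N) (p : B12.RunParams) : Prop :=
  ∃ σ : Sect3Supplier θ χ p, SupplierObligations θ χ p σ ∧ NoExpansionObligation θ χ p σ

end Obligations

/-! ## §3  The data rows at a no-expansion history: def-T's operand rows for a witness value; the witness-free residual rows (pins, measurability, K0b's domination) -/

section Rows

/-- **def-T ∕ def-R's OPERAND ROWS FOR ONE WITNESS VALUE `(t₀, E₀)` AT A HISTORY `s′` OF LENGTH `k+1`**: for every old branch `S` admissible at `init s′`, the operand
`exp A_k(init s′)[t₀, E₀]` read on the multiscale configuration space is measurable, and it is bounded above.  The last conjunct of dag-n11-d's row list, VERBATIM (owner located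
by them: a `Sect2.TermValues` measurability ∕ bound law of def-T; derivable from term rows by their `…OperandRowsOfTermRows`). [cite: Balaban1988Convergent, (2.20)–(2.23) p.258, (3.16)–(3.21) pp.268–269] -/
def OperandRowsAt (k : ℕ) (s : SeqOfRecord F θ.ν θ.τ9.M (gOfRecord₁₃Chi F N θ.toStage13Params χ p) p.K (k + 1)) (t₀ : Sect2.TermValues (F.P p.K) (MatA N) (FluctV N) θ.τ9.M) (E₀ : ℝ) : Prop :=
  ∀ S ∈ admSOfRecord F θ.ν θ.τ9.M (gOfRecord₁₃Chi F N θ.toStage13Params χ p) p.K k s.init,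
    Measurable (fun ω : MultiCfg (F.P p.K) (SU N) (FluctV N) =>
      sect2Operand F N (FluctV N) p.K (settingOfRecord₁₃Chi F N θ.toStage13Params χ p) (θ.rzAtChi χ p s.init) s.init t₀ E₀
          (UbgOfRecord₁₃CoPChi F N θ.toStage13Params χ p k s.init) (S, fun j => (ω j).2) (fun j => (ω j).1)) ∧
    ∃ CΦ : ℝ, ∀ a U, sect2Operand F N (FluctV N) p.K (settingOfRecord₁₃Chi F N θ.toStage13Params χ p) (θ.rzAtChi χ p s.init) s.init t₀ E₀
          (UbgOfRecord₁₃CoPChi F N θ.toStage13Params χ p k s.init) a U ≤ CΦ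

/-- **def-T's OPERAND ROWS ALONG THE CHAIN**: per level `k < K`, given `ChainFormAt θ χ p σ k`, at every no-expansion history with a PRESENT parent, `OperandRowsAt` for the chain's
level-`k` witness value at `init s′`. [cite: Balaban1988Convergent, (2.20)–(2.23) p.258, (3.16)–(3.21) pp.268–269, (3.24) p.270] -/
def OperandRowsAlongChain (σ : Sect3Supplier θ χ p) : Prop :=
  ∀ k, k < p.K → ChainFormAt θ χ p σ k →
    ∀ s : SeqOfRecord F θ.ν θ.τ9.M (gOfRecord₁₃Chi F N θ.toStage13Params χ p) p.K (k + 1), s.Ω (k + 1) = ∅ →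
      slotsOfRecord F N θ.ν θ.τ9 (EOfRecord₁₃Chi F N θ.toStage13Params χ) (wOfRecord₉ F N θ.toStage9Params) θ.ppSel p (gOfRecord₁₃Chi F N θ.toStage13Params χ p) k s.init ≠ 0 →
      OperandRowsAt θ χ p k s ((chainWitness θ χ p σ k).1 s.init) ((chainWitness θ χ p σ k).2 s.init)

end Rows

/-! ## §4  Theorem 1 along the chain and its 𝐓-image, read through the names -/

section Chain

variable {θ χ p}

/-- **THE CHAIN HAS THE §2 FORM AT EVERY LEVEL `k ≤ K` FROM THE NAMED OBLIGATIONS** (`…Sect3SupplyChain.formAtZS_chainWitness` read through `SupplierObligations` and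
`NoExpansionObligation`), on the live-selector line: core provisos (row `rstep`), selector clause, admissibility, `0 ≤ κ, E₀, B₀`, `1 ≤ M`.
[cite: Balaban1988Convergent, Thm 1 p.262, Theorem p.245, Thm 2 p.263, §3 p.279, (3.24)–(3.25) p.270; Balaban1989LargeFieldI, (0.2)–(0.4) p.176, p.177 (i)–(ii)] -/
theorem chainFormAt_all_of_obligations (h : θ.Provisos₁₃CoPHChi F N χ)
    (hsel : θ.ppSel = ppSelLiveOfRecord F N θ.ν θ.τ9 (EOfRecord₁₃Chi F N θ.toStage13Params χ) (wOfRecord₉ F N θ.toStage9Params))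
    (hθ : θ.Admissible F N) (hκ : 0 ≤ θ.s2.lf.κ) (hE₀ : 0 ≤ θ.s2.lf.E₀) (hB₀ : 0 ≤ θ.s2.lf.B₀) (hM : 1 ≤ θ.τ9.M) (σ : Sect3Supplier θ χ p)
    (hσ : SupplierObligations θ χ p σ) (hT : NoExpansionObligation θ χ p σ) : ∀ k, k ≤ p.K → ChainFormAt θ χ p σ k :=
  formAtZS_chainWitness θ χ p h hsel hθ hκ hE₀ hB₀ hM σ hσ.univE hσ.newE hσ.present hT

/-- **THE 𝐓-STEP THROUGH THE NAMES**: from `ChainFormAt θ χ p σ k` (`k < K`) the level-`(k+1)` chain witness is a 𝐓-image witness at level `k` (`…Sect3SupplyChain.formT_spliceTermsB_of_rows`;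
`1 ≤ M`, `0 ≤ B₀`). [cite: Balaban1988Convergent, Theorem p.245, §3 p.279, (3.24)–(3.25) p.270, (2.40)–(2.42) p.261] -/
theorem chainFormTAt_of_chainFormAt (hM : 1 ≤ θ.τ9.M) (hB₀ : 0 ≤ θ.s2.lf.B₀) (σ : Sect3Supplier θ χ p) (hσ : SupplierObligations θ χ p σ) (hT : NoExpansionObligation θ χ p σ)
    {k : ℕ} (hk : k < p.K) (hform : ChainFormAt θ χ p σ k) : ChainFormTAt θ χ p σ k :=
  formT_spliceTermsB_of_rows θ χ p hM hB₀ _ _ hform _ _ (hσ.univE k hk hform) (hσ.newE k hk hform) (hσ.present k hk hform) (hT k hk hform)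

/-- **THE CHAIN's 𝐓-IMAGES AT EVERY LEVEL `k < K`** on the live-selector line. [cite: Balaban1988Convergent, Theorem p.245, §3 p.279, (3.24)–(3.25) p.270] -/
theorem chainFormTAt_all_of_obligations (h : θ.Provisos₁₃CoPHChi F N χ)
    (hsel : θ.ppSel = ppSelLiveOfRecord F N θ.ν θ.τ9 (EOfRecord₁₃Chi F N θ.toStage13Params χ) (wOfRecord₉ F N θ.toStage9Params))
    (hθ : θ.Admissible F N) (hκ : 0 ≤ θ.s2.lf.κ) (hE₀ : 0 ≤ θ.s2.lf.E₀) (hB₀ : 0 ≤ θ.s2.lf.B₀) (hM : 1 ≤ θ.τ9.M) (σ : Sect3Supplier θ χ p)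
    (hσ : SupplierObligations θ χ p σ) (hT : NoExpansionObligation θ χ p σ) : ∀ k, k < p.K → ChainFormTAt θ χ p σ k := fun k hk =>
  chainFormTAt_of_chainFormAt hM hB₀ σ hσ hT hk (chainFormAt_all_of_obligations h hsel hθ hκ hE₀ hB₀ hM σ hσ hT k hk.le)

/-- **★ THE 𝐓-IMAGES OF [III]'s THEOREM p. 245 AT `θ`, ALL LEVELS — `∀ k < K, TLaw₁₃CoPH θ p k` — FROM THE NAMED OBLIGATIONS**: along the chain the «corresponding space»
clause is WITNESSED (by the splice), not merely implied. [cite: Balaban1988Convergent, Theorem p.245, remark p.262, §3 p.279, (3.25) p.270] -/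
theorem tLaw₁₃CoPH_all_of_obligations (h : θ.Provisos₁₃CoPHChi F N χ)
    (hsel : θ.ppSel = ppSelLiveOfRecord F N θ.ν θ.τ9 (EOfRecord₁₃Chi F N θ.toStage13Params χ) (wOfRecord₉ F N θ.toStage9Params))
    (hθ : θ.Admissible F N) (hκ : 0 ≤ θ.s2.lf.κ) (hE₀ : 0 ≤ θ.s2.lf.E₀) (hB₀ : 0 ≤ θ.s2.lf.B₀) (hM : 1 ≤ θ.τ9.M) (σ : Sect3Supplier θ χ p)
    (hσ : SupplierObligations θ χ p σ) (hT : NoExpansionObligation θ χ p σ) : ∀ k, k < p.K → TLaw₁₃CoPHChi F N θ χ p k := fun k hk =>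
  tLaw₁₃CoPH_of_chainFormTAt (chainFormTAt_all_of_obligations h hsel hθ hκ hE₀ hB₀ hM σ hσ hT k hk)

/-- **★ THE THEOREM OF p. 245 IN LAW FORM — `∀ k < K, SLaw₁₃CoPH θ p k → TLaw₁₃CoPH θ p k` — FROM THE NAMED OBLIGATIONS** (the input of every node dictionary:
`B14NodeKnitRecord13RCoPH.thmP245PrintedI_at_record₁₃CoPH_iff_laws`, `…LiveCoPH.densitiesDescribed_at_record₁₃CoPH_of_laws`, def-T's `thm1Printed_datumOfRecord₁₃CoPH_of_tLaw_rOpLeaf`);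
the antecedent is not even read — the chain carries its own witness. [cite: Balaban1988Convergent, Theorem p.245, Thm 1 p.262, remark p.262] -/
theorem thmP245Laws_of_obligations (h : θ.Provisos₁₃CoPHChi F N χ)
    (hsel : θ.ppSel = ppSelLiveOfRecord F N θ.ν θ.τ9 (EOfRecord₁₃Chi F N θ.toStage13Params χ) (wOfRecord₉ F N θ.toStage9Params))
    (hθ : θ.Admissible F N) (hκ : 0 ≤ θ.s2.lf.κ) (hE₀ : 0 ≤ θ.s2.lf.E₀) (hB₀ : 0 ≤ θ.s2.lf.B₀) (hM : 1 ≤ θ.τ9.M) (σ : Sect3Supplier θ χ p)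
    (hσ : SupplierObligations θ χ p σ) (hT : NoExpansionObligation θ χ p σ) : ∀ k, k < p.K → SLaw₁₃CoPHChi F N θ χ p k → TLaw₁₃CoPHChi F N θ χ p k :=
  fun k hk _ => tLaw₁₃CoPH_all_of_obligations h hsel hθ hκ hE₀ hB₀ hM σ hσ hT k hk

/-- **★ THE THEOREM OF p. 245 IN LAW FORM AT `θ` FROM N11's ONE-TOKEN RESIDUAL `SupplyChainAt θ χ p`** on the live-selector line — the `h11`-consequent of the K1 knit.
[cite: Balaban1988Convergent, Theorem p.245, Thm 1 p.262, remark p.262] -/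
theorem thmP245Laws_of_supplyChainAt (h : θ.Provisos₁₃CoPHChi F N χ)
    (hsel : θ.ppSel = ppSelLiveOfRecord F N θ.ν θ.τ9 (EOfRecord₁₃Chi F N θ.toStage13Params χ) (wOfRecord₉ F N θ.toStage9Params))
    (hθ : θ.Admissible F N) (hκ : 0 ≤ θ.s2.lf.κ) (hE₀ : 0 ≤ θ.s2.lf.E₀) (hB₀ : 0 ≤ θ.s2.lf.B₀) (hM : 1 ≤ θ.τ9.M) (hN : SupplyChainAt θ χ p) :
    ∀ k, k < p.K → SLaw₁₃CoPHChi F N θ χ p k → TLaw₁₃CoPHChi F N θ χ p k := by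
  obtain ⟨σ, hσ, hT⟩ := hN
  exact thmP245Laws_of_obligations h hsel hθ hκ hE₀ hB₀ hM σ hσ hT

end Chain

/-! ## §5  Discharging the no-expansion obligation: from the residual + operand rows (dag-n11-d), or at a Gaussian certificate from the operand rows alone (dag-n11-w1) -/

section Discharge

variable {θ χ p}

/-- **★★ `NoExpansionObligation` AT ANY `θ` OF THE GAUSSIAN CERTIFICATE CLASS FROM THE OPERAND ROWS ALONE** (dag-n11-w1's witness-keyed `clause_succ_of_gaussCert_of_witness`
at the chain's witness; absent parents by p580585's zero child): certificate `ζ0`, A-fibre Gaussian `quad`, core provisos, `1 ≤ M`, the supplier's locality (loc),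
`OperandRowsAlongChain θ χ p σ` — NO `ZhUnity`, NO residual row, NO K0b row. [cite: Balaban1988Convergent, Theorem p.245, Thm 1 p.262, (3.24)–(3.25) p.270, (3.23) p.270, (2.23) p.258] -/
theorem noExpansionObligation_of_gaussCert_of_operandRows
    (hζ : ∀ (p : B12.RunParams) (n : ℕ) (Ω Λ : ℕ → Set (Site (F.P p.K) 0)), (θ.Zh p n Ω Λ).ζ0 = (ZhPinOfRecord₁₃ θ.toStage13Params χ p Ω Λ).ζ0)
    (hq : ∀ (p : B12.RunParams) (n : ℕ) (Ω Λ : ℕ → Set (Site (F.P p.K) 0)) (j : ℕ) (Λ' : Set (Site (F.P p.K) 0)) (ω : MultiCfg (F.P p.K) (SU N) (FluctV N)),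
      (θ.Zh p n Ω Λ).quad j Λ' ω = ∑ b ∈ (Set.toFinite (bondsIn j (Λ'ᶜ ∩ Ω (j + 1)))).toFinset, ‖(ω j).2 b‖ ^ 2)
    (h : θ.Provisos₁₃CoPHChi F N χ) (hM : 1 ≤ θ.τ9.M) (σ : Sect3Supplier θ χ p)
    (hloc : ∀ k (s : SeqOfRecord F θ.ν θ.τ9.M (gOfRecord₁₃Chi F N θ.toStage13Params χ p) p.K (k + 1)), IsFluctLocal (k + 1) ((σ k (chainWitness θ χ p σ k).1 (chainWitness θ χ p σ k).2).1 s))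
    (hops : OperandRowsAlongChain θ χ p σ) : NoExpansionObligation θ χ p σ := fun k hk hform s hΩ => by
  by_cases h0 : slotsOfRecord F N θ.ν θ.τ9 (EOfRecord₁₃Chi F N θ.toStage13Params χ) (wOfRecord₉ F N θ.toStage9Params) θ.ppSel p (gOfRecord₁₃Chi F N θ.toStage13Params χ p) k s.init = 0
  · exact Or.inl (slotsTOfRecord₁₃H_succ_eq_zero_of_init_eq_zero θ χ p s h0)
  exact clause_succ_of_gaussCert_of_witness θ χ p hζ hq h hk hM s hΩ _ _ (isFluctLocal_chainWitness θ χ p σ hloc k s.init) (hform.2 s.init).2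
    (hops k hk hform s hΩ h0)

end Discharge

end Summit.QuantumFields.YangMills.Theorems.BalabanUVNodesN11Sect3SupplyChainObligationsDefsChi

end

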